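import Mathlib.MeasureTheory.Constructions.Polish.StronglyMeasurable
import Mathlib.MeasureTheory.Function.LpSpace.Complete
import Literature.Analysis.FunctionSpaces.TorusSpaceTime
import Literature.Analysis.FunctionSpaces.TorusSpaceTimeFields
import Literature.Analysis.FunctionSpaces.TimeMollification
import Literature.Analysis.FunctionSpaces.SpaceTimeWeakCompactness
import HarnessLib

/-!
# Limit fields of `L^∞_t L²_x`-convergent sequences of fields on `ℝ × T^d`

Function-space support for convex-integration limits in `C⁰_t L²_x` (Buckmaster–Vicol 2019,
§2; Luo–Titi 2020, §2.1, proof of Theorem 1: "`∑ ‖v_{q+1} - v_q‖_{L^∞_t L²_x} < ∞`. Thus `v_q`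
converge strongly to some `v ∈ C⁰_t L²_x`"). Given fields `v q : ℝ → T^d → ℝ^d` with increments
bounded in `L²(T^d)` uniformly in time by a summable sequence, `‖v_{q+1}(t) - v_q(t)‖_{L²} ≤ a_q`,
`∑ a_q < ∞`, we construct the limit as an honest function of `(t, x)` and prove what the weak
formulations of the tree need.

## Contents

* **`L²`-Cauchy sequences on a probability space** (general measure space `α`, complete `E`,
  increments `ε : ℕ → ℝ≥0∞`; section `L2Cauchy`): `eLpNorm_sub_le_sum_of_le`,
  `eLpNorm_sub_le_tsum_of_le` (telescoping), `ae_cauchySeq_of_tsum_eLpNorm_ne_top`,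
  `ae_tendsto_limUnder_of_tsum_eLpNorm_ne_top` (summable `L²` increments force a.e. convergence),
  `eLpNorm_limUnder_sub_le_tsum` (Fatou tail bound `‖lim - w_q‖_{L²} ≤ ∑_{i≥0} ε_{q+i}`).
  **refactor:** these five statements are moved here VERBATIM (same names, general form) from
  `Literature/Barriers/NavierStokesRegularity/BuckmasterVicolNonuniquenessLimit` (section
  `L2Cauchy`), where they were first proved for Buckmaster–Vicol's Thm. 1.2; the function-space
  layer is their natural home (a `FunctionSpaces` file must not import a barrier file), and the
  Barriers copies `Literature.Barriers.NavierStokesRegularity.eLpNorm_sub_le_sum_of_le`, …,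
  `….eLpNorm_limUnder_sub_le_tsum` are superseded by the present ones and can be retired by a
  librarian pass (re-pointing that file here).
* `Torus.limitField v t x := limUnder (q ↦ v q t x)` — the pointwise limit packaged as a field,
  with `Torus.limitField_eq_zero` (where all `v q t` vanish, so does the limit) and
  `Torus.stronglyMeasurable_stLift_limitField` — for `v q` with continuous space–time lifts the
  lift of the limit is strongly measurable on `ℝ × ℝ^d` (`StronglyMeasurable.limUnder`);
* torus corollaries of the general section: `Torus.ae_tendsto_limitField`,
  `Torus.eLpNorm_limitField_sub_le` (the rate `‖v(t) - v_q(t)‖_{L²} ≤ ∑_{i≥q} a_i` at every `t`),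
  `Torus.memLp_limitField`, `Torus.eLpNorm_le_uniform`;
* pairings with `φ ∈ L²(T^d)` (NEW): `Torus.continuous_integral_inner_of_continuous_stLift`
  (`t ↦ ∫⟪w(t), φ⟫` is continuous for `w` with continuous lift — tube lemma over the compact
  torus), `Torus.tendstoUniformly_integral_inner_limitField` (pairings converge uniformly in
  time), `Torus.continuous_integral_inner_limitField` (**weak `L²`-continuity of the limit**, the
  `C⁰_weak(ℝ; L²)` clause of Luo–Titi's Def. 1.1), `Torus.tendsto_integral_inner_limitField`.

## Prior art in the tree and in Mathlib; what is new

The a.e.-convergence / Fatou step is the moved `L2Cauchy` block (an alternative route is Mathlib's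
`MeasureTheory.Lp.ae_tendsto_of_cauchy_eLpNorm`, cf. `LpJointMeasurable`); continuity in time of
pairings when the second factor ALSO has a continuous space–time lift is the tree's
`Torus.continuousOn_integral_inner_of_continuousOn_stLift` / `continuousOn_integral_of_continuousOn_stLift`
(`TorusSpaceTimeFields`). New here: the second factor merely in `L²` (so that weak continuity can
be tested against all of `L²`, as Def. 1.1 of Luo–Titi requires), uniform-in-time convergence of
the pairings along the sequence, weak `L²`-continuity and strong measurability of the lifted
limit, and the packaged definition `Torus.limitField` with its every-time `L²` rate.

## References

* T. Luo, E. S. Titi, Calc. Var. PDE 59 (2020) = arXiv:1808.07595, §2.1, proof of Theorem 1.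
  [`LuoTiti2020`]
* T. Buckmaster, V. Vicol, Ann. of Math. 189 (2019), §2 (proof of Thm. 1.1 from Prop. 2.1) and
  §2.4. [`BuckmasterVicol2019AnnMath`]
-/

noncomputable section

open MeasureTheory Set Filter Topology Function
open scoped ENNReal NNReal InnerProductSpace

namespace Literature.Analysis.FunctionSpaces

/-! ## `L²`-Cauchy sequences of fields: a.e. convergence and the Fatou tail bound

Moved verbatim from `BuckmasterVicolNonuniquenessLimit` (section `L2Cauchy`); see the file header. -/

section L2Cauchy

variable {α : Type*} [MeasurableSpace α] {μ : Measure α}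
variable {E : Type*} [NormedAddCommGroup E]

/-- Telescoping: `‖w_{q+m} - w_q‖_{L²} ≤ ∑_{i<m} ε_{q+i}` when `‖w_{n+1} - w_n‖_{L²} ≤ ε_n`.
[folklore] -/
theorem eLpNorm_sub_le_sum_of_le {w : ℕ → α → E} {ε : ℕ → ℝ≥0∞}
    (hw : ∀ n, AEStronglyMeasurable (w n) μ) (hε : ∀ n, eLpNorm (w (n + 1) - w n) 2 μ ≤ ε n)
    (q m : ℕ) : eLpNorm (w (q + m) - w q) 2 μ ≤ ∑ i ∈ Finset.range m, ε (q + i) := by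
  induction m with
  | zero => simp
  | succ m ih =>
    have hsplit : w (q + (m + 1)) - w q = (w (q + m + 1) - w (q + m)) + (w (q + m) - w q) := by
      rw [← add_assoc]; abel
    rw [hsplit, Finset.sum_range_succ]
    calc eLpNorm ((w (q + m + 1) - w (q + m)) + (w (q + m) - w q)) 2 μ
        ≤ eLpNorm (w (q + m + 1) - w (q + m)) 2 μ + eLpNorm (w (q + m) - w q) 2 μ :=
          eLpNorm_add_le ((hw _).sub (hw _)) ((hw _).sub (hw _)) one_le_two
      _ ≤ ε (q + m) + ∑ i ∈ Finset.range m, ε (q + i) := add_le_add (hε _) ih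
      _ = _ := add_comm _ _

/-- `‖w_m - w_q‖_{L²} ≤ ∑_{i ≥ 0} ε_{q+i}` for `q ≤ m`. [folklore] -/
theorem eLpNorm_sub_le_tsum_of_le {w : ℕ → α → E} {ε : ℕ → ℝ≥0∞}
    (hw : ∀ n, AEStronglyMeasurable (w n) μ) (hε : ∀ n, eLpNorm (w (n + 1) - w n) 2 μ ≤ ε n)
    {q m : ℕ} (hqm : q ≤ m) : eLpNorm (w m - w q) 2 μ ≤ ∑' i, ε (q + i) := by
  obtain ⟨n, rfl⟩ := Nat.exists_eq_add_of_le hqm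
  exact (eLpNorm_sub_le_sum_of_le hw hε q n).trans (ENNReal.sum_le_tsum _)

/-- **Summable `L²` increments force a.e. convergence** (on a probability space): if
`∑ ‖w_{n+1} - w_n‖_{L²} < ∞` then `∑ ‖w_{n+1}(x) - w_n(x)‖ < ∞` for a.e. `x` (monotone
convergence and `‖·‖_{L¹} ≤ ‖·‖_{L²}`), so `(w_n(x))` is Cauchy a.e. [folklore] -/
theorem ae_cauchySeq_of_tsum_eLpNorm_ne_top [IsProbabilityMeasure μ] {w : ℕ → α → E}
    (hw : ∀ n, AEStronglyMeasurable (w n) μ)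
    (hsum : ∑' n, eLpNorm (w (n + 1) - w n) 2 μ ≠ ⊤) : ∀ᵐ x ∂μ, CauchySeq (fun n => w n x) := by
  have hmeas : ∀ n, AEMeasurable (fun x => ‖w (n + 1) x - w n x‖ₑ) μ := fun n =>
    ((hw _).sub (hw _)).enorm
  have hG : ∫⁻ x, ∑' n, ‖w (n + 1) x - w n x‖ₑ ∂μ ≤ ∑' n, eLpNorm (w (n + 1) - w n) 2 μ := by
    rw [lintegral_tsum hmeas]
    refine ENNReal.tsum_le_tsum fun n => ?_
    have h1 : ∫⁻ x, ‖w (n + 1) x - w n x‖ₑ ∂μ = eLpNorm (w (n + 1) - w n) 1 μ := by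
      rw [eLpNorm_one_eq_lintegral_enorm]; rfl
    rw [h1]
    have h2 := eLpNorm_le_eLpNorm_mul_rpow_measure_univ (p := 1) (q := 2) (μ := μ) (by norm_num)
      ((hw (n + 1)).sub (hw n))
    simpa using h2
  have hfin : ∀ᵐ x ∂μ, ∑' n, ‖w (n + 1) x - w n x‖ₑ < ⊤ :=
    ae_lt_top' (AEMeasurable.tsum hmeas) (ne_top_of_le_ne_top hsum hG)
  filter_upwards [hfin] with x hx
  refine cauchySeq_of_edist_le_of_tsum_ne_top (fun n => ‖w (n + 1) x - w n x‖ₑ) (fun n => ?_) hx.ne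
  rw [edist_comm, edist_eq_enorm_sub]

variable [CompleteSpace E] [IsProbabilityMeasure μ]

/-- A.e. convergence to the pointwise `limUnder` under summable `L²` increments. [folklore] -/
theorem ae_tendsto_limUnder_of_tsum_eLpNorm_ne_top {w : ℕ → α → E}
    (hw : ∀ n, AEStronglyMeasurable (w n) μ)
    (hsum : ∑' n, eLpNorm (w (n + 1) - w n) 2 μ ≠ ⊤) :
    ∀ᵐ x ∂μ, Tendsto (fun n => w n x) atTop (𝓝 (limUnder atTop fun n => w n x)) := by
  filter_upwards [ae_cauchySeq_of_tsum_eLpNorm_ne_top hw hsum] with x hx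
  exact tendsto_nhds_limUnder (cauchySeq_tendsto_of_complete hx)

/-- **Fatou tail bound.** Under summable `L²` increments `‖w_{n+1} - w_n‖_{L²} ≤ ε_n`,
`∑ ε_n < ∞`, the pointwise limit `w = limUnder w_n` satisfies `‖w - w_q‖_{L²} ≤ ∑_{i ≥ 0} ε_{q+i}`
for every `q` (Fatou's lemma applied to `‖w_n - w_q‖²`, which converges a.e.). [folklore] -/
theorem eLpNorm_limUnder_sub_le_tsum {w : ℕ → α → E} {ε : ℕ → ℝ≥0∞}
    (hw : ∀ n, AEStronglyMeasurable (w n) μ) (hε : ∀ n, eLpNorm (w (n + 1) - w n) 2 μ ≤ ε n)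
    (hsum : ∑' n, ε n ≠ ⊤) (q : ℕ) :
    eLpNorm (fun x => (limUnder atTop fun n => w n x) - w q x) 2 μ ≤ ∑' i, ε (q + i) := by
  set u : α → E := fun x => limUnder atTop fun n => w n x with hu
  have hsum' : ∑' n, eLpNorm (w (n + 1) - w n) 2 μ ≠ ⊤ :=
    ne_top_of_le_ne_top hsum (ENNReal.tsum_le_tsum hε)
  have hae := ae_tendsto_limUnder_of_tsum_eLpNorm_ne_top hw hsum'
  have hpt : ∀ᵐ x ∂μ, ‖u x - w q x‖ₑ ^ 2 = liminf (fun n => ‖w n x - w q x‖ₑ ^ 2) atTop := by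
    filter_upwards [hae] with x hx
    have h : Tendsto (fun n => ‖w n x - w q x‖ₑ ^ 2) atTop (𝓝 (‖u x - w q x‖ₑ ^ 2)) :=
      ENNReal.Tendsto.pow ((hx.sub_const (w q x)).enorm)
    exact h.liminf_eq.symm
  have h2 : ∫⁻ x, ‖u x - w q x‖ₑ ^ 2 ∂μ ≤ (∑' i, ε (q + i)) ^ 2 := by
    calc ∫⁻ x, ‖u x - w q x‖ₑ ^ 2 ∂μ
        = ∫⁻ x, liminf (fun n => ‖w n x - w q x‖ₑ ^ 2) atTop ∂μ := lintegral_congr_ae hpt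
      _ ≤ liminf (fun n => ∫⁻ x, ‖w n x - w q x‖ₑ ^ 2 ∂μ) atTop :=
          lintegral_liminf_le' fun n => ((hw n).sub (hw q)).enorm.pow_const 2
      _ ≤ (∑' i, ε (q + i)) ^ 2 := by
          refine liminf_le_of_frequently_le (Eventually.frequently ?_)
          filter_upwards [eventually_ge_atTop q] with n hn
          have h := eLpNorm_sub_le_tsum_of_le hw hε hn
          rw [← eLpNorm_two_pow_two_eq_lintegral]
          change eLpNorm (w n - w q) 2 μ ^ 2 ≤ (∑' i, ε (q + i)) ^ 2
          gcongr
  have h3 : eLpNorm (fun x => u x - w q x) 2 μ ^ 2 ≤ (∑' i, ε (q + i)) ^ 2 := by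
    rw [eLpNorm_two_pow_two_eq_lintegral]
    exact h2
  exact (ENNReal.pow_le_pow_left_iff two_ne_zero).1 h3

end L2Cauchy

section RealIncrements

/-- The real increments `a` as extended reals: `∑ ofReal (a (q+i)) = ofReal (∑_{i} a (i+q))`
and the total `∑ ofReal (a i) = ofReal (∑ a) < ∞`. [folklore] -/
theorem tsum_ofReal_shift_eq {a : ℕ → ℝ} (ha : Summable a) (ha0 : ∀ q, 0 ≤ a q) (q : ℕ) :
    ∑' i, ENNReal.ofReal (a (q + i)) = ENNReal.ofReal (∑' i, a (i + q)) := by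
  have hs : Summable fun i => a (i + q) := (summable_nat_add_iff q).2 ha
  rw [ENNReal.ofReal_tsum_of_nonneg (fun i => ha0 _) hs]
  exact tsum_congr fun i => by rw [add_comm]

end RealIncrements

namespace Torus

variable {d : Type*} [Fintype d]

/-! ## The pointwise limit field -/

/-- The **pointwise limit field** of a sequence of space–time fields: `limitField v t x` is the
limit of `q ↦ v q t x` where this sequence converges (and an unspecified value elsewhere — for the
sequences of this file, a null set of `x` for every `t`). [folklore] -/
def limitField (v : ℕ → ℝ → UnitAddTorus d → EuclideanSpace ℝ d) (t : ℝ) (x : UnitAddTorus d) :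
    EuclideanSpace ℝ d :=
  limUnder atTop fun q => v q t x

omit [Fintype d] in
/-- Unfolding `limitField`. [folklore] -/
theorem limitField_apply (v : ℕ → ℝ → UnitAddTorus d → EuclideanSpace ℝ d) (t : ℝ) (x : UnitAddTorus d) :
    limitField v t x = limUnder atTop fun q => v q t x :=
  rfl

/-- Where the sequence converges, the limit field is its limit. [folklore] -/
theorem limitField_eq_of_tendsto {v : ℕ → ℝ → UnitAddTorus d → EuclideanSpace ℝ d} {t : ℝ}
    {x : UnitAddTorus d} {c : EuclideanSpace ℝ d} (h : Tendsto (fun q => v q t x) atTop (𝓝 c)) :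
    limitField v t x = c :=
  h.limUnder_eq

/-- Where every `v q t` vanishes identically, so does the limit field. [folklore] -/
theorem limitField_eq_zero {v : ℕ → ℝ → UnitAddTorus d → EuclideanSpace ℝ d} {t : ℝ}
    (h : ∀ q, v q t = 0) : limitField v t = 0 := by
  funext x
  have hc : Tendsto (fun q => v q t x) atTop (𝓝 0) := by
    have : (fun q => v q t x) = fun _ => 0 := funext fun q => by rw [h q]; rfl
    rw [this]
    exact tendsto_const_nhds
  exact limitField_eq_of_tendsto hc

/-- **Measurability of the limit field**: if every `v q` has a continuous space–time lift, the
space–time lift of `limitField v` is strongly measurable on `ℝ × ℝ^d` (pointwise `limUnder` of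
continuous, hence strongly measurable, maps: `StronglyMeasurable.limUnder`). [folklore] -/
theorem stronglyMeasurable_stLift_limitField {v : ℕ → ℝ → UnitAddTorus d → EuclideanSpace ℝ d}
    (hvc : ∀ q, Continuous (stLift (v q))) : StronglyMeasurable (stLift (limitField v)) := by
  have h : stLift (limitField v) = fun p => limUnder atTop fun q => stLift (v q) p := by
    funext p
    rfl
  rw [h]
  exact StronglyMeasurable.limUnder fun q => (hvc q).stronglyMeasurable

/-- The a.e. form consumed by the weak formulations (`Torus.IsWeakFracNSSolutionLine`, first
clause). [folklore] -/
theorem aestronglyMeasurable_stLift_limitField {v : ℕ → ℝ → UnitAddTorus d → EuclideanSpace ℝ d}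
    (hvc : ∀ q, Continuous (stLift (v q))) :
    AEStronglyMeasurable (stLift (limitField v)) (volume : Measure (ℝ × EuclideanSpace ℝ d)) :=
  (stronglyMeasurable_stLift_limitField hvc).aestronglyMeasurable

/-! ## `L²` control: a.e. convergence and the rate -/

section L2

variable {v : ℕ → ℝ → UnitAddTorus d → EuclideanSpace ℝ d} {a : ℕ → ℝ}

omit [Fintype d] in
/-- Slices of a field with continuous space–time lift are continuous. [folklore] -/
theorem continuous_slice_of_continuous_stLift {F : Type*} [NormedAddCommGroup F]
    {w : ℝ → UnitAddTorus d → F} (hw : Continuous (stLift w)) (t : ℝ) : Continuous (w t) :=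
  continuous_slice_of_continuousOn_stLift (S := univ) hw.continuousOn (mem_univ t)

/-- Slices of a field with continuous space–time lift are in `L²(T^d)` (bounded on the compact
torus, which has volume one). [folklore] -/
theorem memLp_two_slice_of_continuous_stLift {w : ℝ → UnitAddTorus d → EuclideanSpace ℝ d}
    (hw : Continuous (stLift w)) (t : ℝ) : MemLp (w t) 2 volume := by
  have hc : Continuous (w t) := continuous_slice_of_continuous_stLift hw t
  obtain ⟨C, hC⟩ := isCompact_univ.exists_bound_of_continuousOn hc.continuousOn
  have htop : MemLp (w t) ⊤ volume :=
    memLp_top_of_bound hc.aestronglyMeasurable C (ae_of_all _ fun x => hC x (mem_univ x))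
  exact htop.mono_exponent le_top

/-- **Almost-everywhere convergence**: for every time `t`, the sequence `v q t x` converges to
`limitField v t x` for a.e. `x` (torus form of `ae_tendsto_limUnder_of_tsum_eLpNorm_ne_top`).
[folklore] -/
theorem ae_tendsto_limitField (hvc : ∀ q, Continuous (stLift (v q))) (ha : Summable a)
    (ha0 : ∀ q, 0 ≤ a q)
    (hstep : ∀ q t, eLpNorm (v (q + 1) t - v q t) 2 volume ≤ ENNReal.ofReal (a q)) (t : ℝ) :
    ∀ᵐ x ∂(volume : Measure (UnitAddTorus d)),
      Tendsto (fun q => v q t x) atTop (𝓝 (limitField v t x)) := by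
  have hmeas : ∀ m, AEStronglyMeasurable (v m t) volume := fun m =>
    (continuous_slice_of_continuous_stLift (hvc m) t).aestronglyMeasurable
  have hsum : ∑' n, eLpNorm (v (n + 1) t - v n t) 2 volume ≠ ⊤ := by
    refine ne_top_of_le_ne_top ?_ (ENNReal.tsum_le_tsum fun n => hstep n t)
    rw [← ENNReal.ofReal_tsum_of_nonneg ha0 ha]
    exact ENNReal.ofReal_ne_top
  exact ae_tendsto_limUnder_of_tsum_eLpNorm_ne_top hmeas hsum

/-- **The rate of convergence in `L²`, uniformly in time**: `‖v(t) - v_q(t)‖_{L²} ≤ ∑_{i≥q} a_i`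
for every `t` (torus form of the Fatou tail bound `eLpNorm_limUnder_sub_le_tsum`). [folklore] -/
theorem eLpNorm_limitField_sub_le (hvc : ∀ q, Continuous (stLift (v q))) (ha : Summable a)
    (ha0 : ∀ q, 0 ≤ a q)
    (hstep : ∀ q t, eLpNorm (v (q + 1) t - v q t) 2 volume ≤ ENNReal.ofReal (a q)) (q : ℕ) (t : ℝ) :
    eLpNorm (limitField v t - v q t) 2 volume ≤ ENNReal.ofReal (∑' i, a (i + q)) := by
  have hmeas : ∀ m, AEStronglyMeasurable (v m t) volume := fun m =>
    (continuous_slice_of_continuous_stLift (hvc m) t).aestronglyMeasurable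
  have hsum : ∑' n, ENNReal.ofReal (a n) ≠ ⊤ := by
    rw [← ENNReal.ofReal_tsum_of_nonneg ha0 ha]
    exact ENNReal.ofReal_ne_top
  have h := eLpNorm_limUnder_sub_le_tsum (w := fun n => v n t) hmeas (fun n => hstep n t) hsum q
  rw [tsum_ofReal_shift_eq ha ha0 q] at h
  exact h

/-- Distance to the start: `‖v_q(t) - v₀(t)‖_{L²} ≤ ∑ a` for every `q`, `t`. [folklore] -/
theorem eLpNorm_sub_zero_le (hvc : ∀ q, Continuous (stLift (v q))) (ha : Summable a)
    (ha0 : ∀ q, 0 ≤ a q)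
    (hstep : ∀ q t, eLpNorm (v (q + 1) t - v q t) 2 volume ≤ ENNReal.ofReal (a q)) (q : ℕ) (t : ℝ) :
    eLpNorm (v q t - v 0 t) 2 volume ≤ ENNReal.ofReal (∑' i, a i) := by
  have hmeas : ∀ m, AEStronglyMeasurable (v m t) volume := fun m =>
    (continuous_slice_of_continuous_stLift (hvc m) t).aestronglyMeasurable
  have h := eLpNorm_sub_le_tsum_of_le (w := fun n => v n t) (ε := fun n => ENNReal.ofReal (a n)) hmeas
    (fun n => hstep n t) (Nat.zero_le q)
  have h0 := tsum_ofReal_shift_eq ha ha0 0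
  simp only [zero_add, add_zero] at h h0
  rw [h0] at h
  exact h

/-- The slices of the limit field are a.e. strongly measurable. [folklore] -/
theorem aestronglyMeasurable_limitField (hvc : ∀ q, Continuous (stLift (v q))) (ha : Summable a)
    (ha0 : ∀ q, 0 ≤ a q)
    (hstep : ∀ q t, eLpNorm (v (q + 1) t - v q t) 2 volume ≤ ENNReal.ofReal (a q)) (t : ℝ) :
    AEStronglyMeasurable (limitField v t) volume :=
  aestronglyMeasurable_of_tendsto_ae atTop
    (fun q => (continuous_slice_of_continuous_stLift (hvc q) t).aestronglyMeasurable)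
    (ae_tendsto_limitField hvc ha ha0 hstep t)

/-- **The limit field is in `L²` at every time.** [folklore] -/
theorem memLp_limitField (hvc : ∀ q, Continuous (stLift (v q))) (ha : Summable a)
    (ha0 : ∀ q, 0 ≤ a q)
    (hstep : ∀ q t, eLpNorm (v (q + 1) t - v q t) 2 volume ≤ ENNReal.ofReal (a q)) (t : ℝ) :
    MemLp (limitField v t) 2 volume := by
  have hmeas := aestronglyMeasurable_limitField hvc ha ha0 hstep t
  have hv0 : MemLp (v 0 t) 2 volume := memLp_two_slice_of_continuous_stLift (hvc 0) t
  have hdiff : MemLp (limitField v t - v 0 t) 2 volume := by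
    refine ⟨hmeas.sub hv0.1, ?_⟩
    have h := eLpNorm_limitField_sub_le hvc ha ha0 hstep 0 t
    exact h.trans_lt ENNReal.ofReal_lt_top
  have h := hdiff.add hv0
  rwa [sub_add_cancel] at h

/-- A uniform `L²` bound along the sequence and for the limit: if `‖v₀(t)‖_{L²} ≤ M₀` for all
`t`, then `‖v_q(t)‖_{L²} ≤ M₀ + ∑ a` and `‖v(t)‖_{L²} ≤ M₀ + ∑ a` for all `q`, `t`. [folklore] -/
theorem eLpNorm_le_uniform (hvc : ∀ q, Continuous (stLift (v q))) (ha : Summable a)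
    (ha0 : ∀ q, 0 ≤ a q)
    (hstep : ∀ q t, eLpNorm (v (q + 1) t - v q t) 2 volume ≤ ENNReal.ofReal (a q)) {M₀ : ℝ}
    (hM₀ : ∀ t, eLpNorm (v 0 t) 2 volume ≤ ENNReal.ofReal M₀) (h0 : 0 ≤ M₀) (q : ℕ) (t : ℝ) :
    eLpNorm (v q t) 2 volume ≤ ENNReal.ofReal (M₀ + ∑' i, a i) ∧
      eLpNorm (limitField v t) 2 volume ≤ ENNReal.ofReal (M₀ + ∑' i, a i) := by
  have hmeas : ∀ m, AEStronglyMeasurable (v m t) volume := fun m =>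
    (continuous_slice_of_continuous_stLift (hvc m) t).aestronglyMeasurable
  have hta : 0 ≤ ∑' i, a i := tsum_nonneg ha0
  have htail : ∀ q, ∑' i, a (i + q) ≤ ∑' i, a i := fun q =>
    (summable_nat_add_iff q |>.2 ha).tsum_le_tsum_of_inj (fun i => i + q) (add_left_injective q)
      (fun i _ => ha0 i) (fun i => le_rfl) ha
  constructor
  · have h1 : eLpNorm (v q t) 2 volume ≤ eLpNorm (v q t - v 0 t) 2 volume + eLpNorm (v 0 t) 2 volume := by
      have := eLpNorm_add_le ((hmeas q).sub (hmeas 0)) (hmeas 0) one_le_two (μ := volume)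
        (f := v q t - v 0 t) (g := v 0 t)
      rwa [sub_add_cancel] at this
    have h2 : eLpNorm (v q t - v 0 t) 2 volume ≤ ENNReal.ofReal (∑' i, a i) :=
      eLpNorm_sub_zero_le hvc ha ha0 hstep q t
    calc eLpNorm (v q t) 2 volume ≤ ENNReal.ofReal (∑' i, a i) + ENNReal.ofReal M₀ :=
          h1.trans (add_le_add h2 (hM₀ t))
      _ = ENNReal.ofReal (M₀ + ∑' i, a i) := by rw [← ENNReal.ofReal_add hta h0, add_comm]
  · have hmu := aestronglyMeasurable_limitField hvc ha ha0 hstep t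
    have h1 : eLpNorm (limitField v t) 2 volume ≤
        eLpNorm (limitField v t - v 0 t) 2 volume + eLpNorm (v 0 t) 2 volume := by
      have := eLpNorm_add_le (hmu.sub (hmeas 0)) (hmeas 0) one_le_two (μ := volume)
        (f := limitField v t - v 0 t) (g := v 0 t)
      rwa [sub_add_cancel] at this
    have h2 : eLpNorm (limitField v t - v 0 t) 2 volume ≤ ENNReal.ofReal (∑' i, a i) :=
      (eLpNorm_limitField_sub_le hvc ha ha0 hstep 0 t).trans (ENNReal.ofReal_le_ofReal (by simp))
    calc eLpNorm (limitField v t) 2 volume ≤ ENNReal.ofReal (∑' i, a i) + ENNReal.ofReal M₀ :=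
          h1.trans (add_le_add h2 (hM₀ t))
      _ = ENNReal.ofReal (M₀ + ∑' i, a i) := by rw [← ENNReal.ofReal_add hta h0, add_comm]

end L2

/-! ## Pairings: continuity in time, convergence, weak continuity of the limit -/

section Pairing

variable {v : ℕ → ℝ → UnitAddTorus d → EuclideanSpace ℝ d} {a : ℕ → ℝ}

/-- **Pairings of fields with continuous space–time lift are continuous in time**: for `w` with
`Continuous (stLift w)` and `φ ∈ L²(T^d)`, `t ↦ ∫⟪w(t), φ⟫` is continuous (`w(s) → w(t)`
uniformly on the compact torus, `Torus.eventually_norm_sub_lt_of_continuousOn`). [folklore] -/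
theorem continuous_integral_inner_of_continuous_stLift {w : ℝ → UnitAddTorus d → EuclideanSpace ℝ d}
    (hw : Continuous (stLift w)) {φ : UnitAddTorus d → EuclideanSpace ℝ d} (hφ : MemLp φ 2 volume) :
    Continuous fun t => ∫ x, ⟪w t x, φ x⟫_ℝ := by
  have hφ1 : Integrable φ volume := hφ.integrable one_le_two
  have hint : ∀ s, Integrable (fun x => ⟪w s x, φ x⟫_ℝ) volume := fun s => by
    simpa only [real_inner_comm] using
      integrable_inner_of_continuous hφ1 (continuous_slice_of_continuous_stLift hw s)
  refine continuous_iff_continuousAt.2 fun t => ?_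
  rw [ContinuousAt, Metric.tendsto_nhds]
  intro ε hε
  set I : ℝ := ∫ x, ‖φ x‖ with hI_def
  have hI0 : 0 ≤ I := integral_nonneg fun x => norm_nonneg _
  have hη : 0 < ε / (I + 1) := div_pos hε (by linarith)
  have h := eventually_norm_sub_lt_of_continuousOn hw.continuousOn (mem_univ t) hη
  rw [nhdsWithin_univ] at h
  filter_upwards [h] with s hs
  rw [dist_eq_norm, ← integral_sub (hint s) (hint t)]
  have heq : (fun x => ⟪w s x, φ x⟫_ℝ - ⟪w t x, φ x⟫_ℝ) = fun x => ⟪w s x - w t x, φ x⟫_ℝ := by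
    funext x; rw [inner_sub_left]
  rw [heq]
  calc ‖∫ x, ⟪w s x - w t x, φ x⟫_ℝ‖ ≤ ∫ x, ε / (I + 1) * ‖φ x‖ := by
        refine norm_integral_le_of_norm_le (hφ1.norm.const_mul _) (ae_of_all _ fun x => ?_)
        calc ‖⟪w s x - w t x, φ x⟫_ℝ‖ ≤ ‖w s x - w t x‖ * ‖φ x‖ := norm_inner_le_norm _ _
          _ ≤ ε / (I + 1) * ‖φ x‖ := mul_le_mul_of_nonneg_right (hs x).le (norm_nonneg _)
    _ = ε / (I + 1) * I := by rw [integral_const_mul]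
    _ < ε := by
        rw [div_mul_eq_mul_div, div_lt_iff₀ (by linarith)]
        nlinarith

/-- **Cauchy–Schwarz for differences of pairings**: for `F, G, φ ∈ L²(T^d)`,
`‖∫⟪F, φ⟫ - ∫⟪G, φ⟫‖ ≤ (‖F - G‖_{L²} ‖φ‖_{L²}).toReal`. [folklore] -/
theorem norm_integral_inner_sub_integral_inner_le {F G φ : UnitAddTorus d → EuclideanSpace ℝ d}
    (hF : MemLp F 2 volume) (hG : MemLp G 2 volume) (hφ : MemLp φ 2 volume) :
    ‖(∫ x, ⟪F x, φ x⟫_ℝ) - ∫ x, ⟪G x, φ x⟫_ℝ‖ ≤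
      (eLpNorm (F - G) 2 volume * eLpNorm φ 2 volume).toReal := by
  have hiF : Integrable (fun x => ⟪F x, φ x⟫_ℝ) volume :=
    integrable_inner_of_eLpNorm_two_lt_top hF.1 hφ.1 hF.2 hφ.2
  have hiG : Integrable (fun x => ⟪G x, φ x⟫_ℝ) volume :=
    integrable_inner_of_eLpNorm_two_lt_top hG.1 hφ.1 hG.2 hφ.2
  rw [← integral_sub hiF hiG]
  have heq : (fun x => ⟪F x, φ x⟫_ℝ - ⟪G x, φ x⟫_ℝ) = fun x => ⟪(F - G) x, φ x⟫_ℝ := by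
    funext x; rw [Pi.sub_apply, inner_sub_left]
  rw [heq]
  have h := enorm_integral_inner_le_eLpNorm_mul (hF.1.sub hG.1) hφ.1 (π := volume) (F := F - G) (G := φ)
  have hfin : eLpNorm (F - G) 2 volume * eLpNorm φ 2 volume ≠ ⊤ :=
    ENNReal.mul_ne_top (hF.sub hG).2.ne hφ.2.ne
  rw [← ENNReal.ofReal_le_iff_le_toReal hfin, ofReal_norm]
  exact h

/-- **Pairings converge, uniformly in time**: `∫⟪v_q(t), φ⟫ → ∫⟪v(t), φ⟫` uniformly in `t`
for every `φ ∈ L²` (`|∫⟪v_q(t) - v(t), φ⟫| ≤ ‖v_q(t) - v(t)‖_{L²} ‖φ‖_{L²} ≤ (∑_{i≥q} a_i) ‖φ‖_{L²}`). [folklore] -/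
theorem tendstoUniformly_integral_inner_limitField (hvc : ∀ q, Continuous (stLift (v q))) (ha : Summable a)
    (ha0 : ∀ q, 0 ≤ a q)
    (hstep : ∀ q t, eLpNorm (v (q + 1) t - v q t) 2 volume ≤ ENNReal.ofReal (a q))
    {φ : UnitAddTorus d → EuclideanSpace ℝ d} (hφ : MemLp φ 2 volume) :
    TendstoUniformly (fun q t => ∫ x, ⟪v q t x, φ x⟫_ℝ) (fun t => ∫ x, ⟪limitField v t x, φ x⟫_ℝ)
      atTop := by
  rw [Metric.tendstoUniformly_iff]
  intro ε hε
  -- the tails in `ℝ≥0∞`, times `‖φ‖_{L²}`, tend to zero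
  have htail : Tendsto (fun q => ENNReal.ofReal (∑' i, a (i + q)) * eLpNorm φ 2 volume) atTop (𝓝 0) := by
    have h1 : Tendsto (fun q => ∑' i, a (i + q)) atTop (𝓝 0) := tendsto_sum_nat_add a
    have h2 : Tendsto (fun q => ENNReal.ofReal (∑' i, a (i + q))) atTop (𝓝 0) := by
      have := ENNReal.tendsto_ofReal h1
      rwa [ENNReal.ofReal_zero] at this
    have h3 := ENNReal.Tendsto.mul_const h2 (Or.inr hφ.2.ne)
    rwa [zero_mul] at h3
  have hev : ∀ᶠ q in atTop, ENNReal.ofReal (∑' i, a (i + q)) * eLpNorm φ 2 volume < ENNReal.ofReal ε :=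
    (tendsto_order.1 htail).2 _ (ENNReal.ofReal_pos.2 hε)
  filter_upwards [hev] with q hq t
  have hu : MemLp (limitField v t) 2 volume := memLp_limitField hvc ha ha0 hstep t
  have hvq : MemLp (v q t) 2 volume := memLp_two_slice_of_continuous_stLift (hvc q) t
  rw [dist_comm, dist_eq_norm]
  have h1 := norm_integral_inner_sub_integral_inner_le hvq hu hφ
  have h2 : eLpNorm (v q t - limitField v t) 2 volume ≤ ENNReal.ofReal (∑' i, a (i + q)) := by
    rw [← eLpNorm_neg, neg_sub]
    exact eLpNorm_limitField_sub_le hvc ha ha0 hstep q t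
  have h3 : eLpNorm (v q t - limitField v t) 2 volume * eLpNorm φ 2 volume < ENNReal.ofReal ε :=
    lt_of_le_of_lt (mul_le_mul' h2 le_rfl) hq
  refine lt_of_le_of_lt h1 ?_
  exact (ENNReal.toReal_lt_of_lt_ofReal h3)

/-- **Weak `L²`-continuity of the limit field**: `t ↦ ∫⟪v(t), φ⟫` is continuous for every
`φ ∈ L²(T^d)` (uniform limit of the continuous pairings of the `v_q`; Luo–Titi's
`v ∈ C⁰_t L²_x ⊆ C⁰_weak(ℝ; L²)`). [folklore] -/
theorem continuous_integral_inner_limitField (hvc : ∀ q, Continuous (stLift (v q))) (ha : Summable a)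
    (ha0 : ∀ q, 0 ≤ a q)
    (hstep : ∀ q t, eLpNorm (v (q + 1) t - v q t) 2 volume ≤ ENNReal.ofReal (a q))
    {φ : UnitAddTorus d → EuclideanSpace ℝ d} (hφ : MemLp φ 2 volume) :
    Continuous fun t => ∫ x, ⟪limitField v t x, φ x⟫_ℝ :=
  (tendstoUniformly_integral_inner_limitField hvc ha ha0 hstep hφ).continuous
    (Eventually.of_forall fun q => continuous_integral_inner_of_continuous_stLift (hvc q) hφ).frequently

/-- Pairings converge at every time: `∫⟪v_q(t), φ⟫ → ∫⟪v(t), φ⟫`. [folklore] -/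
theorem tendsto_integral_inner_limitField (hvc : ∀ q, Continuous (stLift (v q))) (ha : Summable a)
    (ha0 : ∀ q, 0 ≤ a q)
    (hstep : ∀ q t, eLpNorm (v (q + 1) t - v q t) 2 volume ≤ ENNReal.ofReal (a q))
    {φ : UnitAddTorus d → EuclideanSpace ℝ d} (hφ : MemLp φ 2 volume) (t : ℝ) :
    Tendsto (fun q => ∫ x, ⟪v q t x, φ x⟫_ℝ) atTop (𝓝 (∫ x, ⟪limitField v t x, φ x⟫_ℝ)) :=
  (tendstoUniformly_integral_inner_limitField hvc ha ha0 hstep hφ).tendsto_at t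

end Pairing

end Torus

end Literature.Analysis.FunctionSpaces
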